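import Summits.ResolutionOfSingularities.ResolutionOfSingularities.Theorems.HilbertSamuelEliminationSigmaMaxModificationsCorridor3WLadderMovingDefs
import HarnessLib

/-!
# [OURS · L1 W4.2] Row `stub_Wlow3M_two` (crux chain w42, line `w_ladder` v5b) — DEFINITIONS for the characteristic-2
# threefold re-run: the geometric-directrix form (F1♯) of the characteristic hypothesis and the OURS carriers

Stub worker res-L1-w42-stub-3 (gen 3). CHAIN v3.8 / v3.8a rulings (D-1)–(D-4), (a-4): at W-low (`ē ≤ 2`) the directrix
theorem 2.14♯ («x′ near x under a permissible blow-up with centre `D ∋ x` ⇒ x′ ∈ ℙ(Dir_x(X)/T_x(D)) whenever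
`char κ(x) = 0` or `ē_x(X) − dim_x D ≤ 2·char κ(x) − 2`», OURS candidate from [H4] Th. IV / [H5] Th. 2 / Mizutani 2.8,
to be typed as `Directrix214Sharp`, T7) is available at every use that the printed proofs of CJS Thm 6.35 / Cor 6.37 /
Thm 6.40 make of Thm 3.14 (memo `HOME/L/res-L1-w42-stub-3/BETA-UNITS-SCOPE.md`: all uses are at closed chain points with a
point or regular-curve centre, or at the generic points `η_q` of the unit lines `C_q ≅ ℙ¹`; `ē ≤ 2` there by Thm 3.10 (4)),
so the rows β ∪ γ of `stub_Wlow3M_two` (p = 2, dim X = 3, ANY residue field) are «print + 2.14♯ + memo». The carriers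
are typed HERE, following the pattern of `CharHypothesis` (`KeyTheorems.lean`): replace `dim X` by `ē_x(X)`.

* `GeomDirHypothesis X x` — (F1♯) «`char κ(x) = 0 ∨ ē_x(X) + 2 ≤ 2·char κ(x)`» (the 2.14♯ range for a POINT centre at `x`;
  implied by `CharHypothesis X x` since `ē_x ≤ dim X`; AUTOMATIC when `ē_x(X) ≤ 2`, since the characteristic of a field is
  `0` or a prime `≥ 2` — in particular at the initial point of every fundamental unit, Def. 6.38 (i)).
* `Corollary637_geomDir` — OURS CLAIM «CJS Cor 6.37 with (F1) replaced by (F1♯)» (typed `Corollary637_char` with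
  `CharHypothesis (T.X 0) x` ↦ `GeomDirHypothesis (T.X 0) x`); strictly between the char-free typed `Corollary637` (which it
  follows from) and the print-faithful `Corollary637_char` (which it implies). Status: CONDITIONAL (print + 2.14♯ + memo);
  NOT a statement of LNM 2270.
* `KeyTheorem640_geomDir_isolated` — «CJS Thm 6.40 (isolated initial points) with (F1) replaced by (F1♯)»; since units have
  `ē = 2` at their initial point, (F1♯) is automatic and this is EQUIVALENT to the typed char-free `KeyTheorem640_isolated`
  (proved in the companion `…MovingTwo.lean`): the honest carrier of Thm 6.40 for the characteristic-2 row is the char-free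
  typed fact itself — «print + 2.14♯ + memo» in every characteristic and dimension.
* `UnitTowerExtractionFreeM p` — idea-2's bridge `UnitTowerExtractionM p` (§3a of `…MovingDefs`) WITHOUT the conjunct
  `CharHypothesis (T.X 0) (pt 0)` in its conclusion (unbuildable at `p = 2`, `dim X = 3`: `3 + 2 ≤ 4` fails) — exactly what
  `KeyTheorem640_isolated` consumes; ALL maximal origins, no regime predicate.

Everything here is a DEFINITION (no `sorry`, nothing asserted); the reductions are in `…Corridor3WLadderMovingTwo.lean`.
OURS (cell res-hironaka, slot W4.2); NOT statements of the manuscript [Hironaka2017] nor of [CossartJannsenSaito2020];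
AI-drafted, weaker than expert review. References: CJS LNM 2270 p. 103 (F1), Thm. 3.10 (4), Thm. 3.14, Cor. 6.37,
Def. 6.38, Thm. 6.40, Thm. 10.2 [CossartJannsenSaito2020]; H. Mizutani, Nagoya Math. J. 52 (1973) Thm. 2.8
[Mizutani1973HironakaGroupSchemes]; tree `…/CossartJannsenSaito2020/KeyTheorems.lean`, `KeyTheoremsIsolated.lean`,
`NearPointDirectrix.lean` (p499700).
-/

noncomputable section

-- plan-1/idea-2 module setting kept verbatim (namespace `…Corridor3.Moving` re-enters `…Corridor3`)
set_option linter.dupNamespace false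

open CategoryTheory AlgebraicGeometry TopologicalSpace IsLocalRing
open Summit.ResolutionOfSingularities.ResolutionOfSingularities.Theorems.CampaignW42
open Literature.AlgebraicGeometry.Resolution Literature.RingTheory.HilbertSamuel
open Literature.AlgebraicGeometry.CossartJannsenSaito2020
open Summit.ResolutionOfSingularities.ResolutionOfSingularities.Theses.HilbertSamuelElimination
open Summit.ResolutionOfSingularities.ResolutionOfSingularities.Theorems.SigmaMaxModificationsCorridor3

namespace Summit.ResolutionOfSingularities.ResolutionOfSingularities.Theorems.SigmaMaxModificationsCorridor3.Moving

universe u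

/-! ## (F1♯): the geometric-directrix form of the characteristic hypothesis -/

/-- [OURS · L1 W4.2] **(F1♯)** at a point `x ∈ X`: «`char κ(x) = 0` or `ē_x(X) + 2 ≤ 2·char κ(x)`» — the range in which
the directrix theorem 2.14♯ confines the near points of the blow-up of the POINT `x` (centre of dimension `0`); the typed
`CharHypothesis X x` («`dim X + 2 ≤ 2·char`», CJS (F1) / Thm. 10.2) with `dim X` replaced by `ē_x(X) = Scheme.geomDirDim X x`.
[cite: CossartJannsenSaito2020, Thm. 10.2, Thm. 3.14] -/
def GeomDirHypothesis (X : Scheme.{u}) [IsLocallyNoetherian X] (x : X) : Prop :=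
  ringChar (ResidueField (X.presheaf.stalk x)) = 0 ∨
    Scheme.geomDirDim X x + 2 ≤ 2 * ringChar (ResidueField (X.presheaf.stalk x))

/-! ## The OURS carriers of Cor. 6.37 / Thm. 6.40 for the characteristic-2 threefold row -/

/-- [OURS · L1 W4.2] replaces the role of CJS Cor. 6.37 for the row `stub_Wlow3M_two` (p = 2, dim X = 3): the typed
print-faithful `Corollary637_char` with its characteristic hypothesis (F1) `CharHypothesis (T.X 0) x` REPLACED by (F1♯)
`GeomDirHypothesis (T.X 0) x` — «a fundamental sequence (Def. 6.34) starting at a point `x` isolated in `X_max` with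
`e_x(X) = 1` and `char κ(x) = 0 ∨ ē_x(X) + 2 ≤ 2·char κ(x)` is finite and consists of blow-ups in closed points».
NOT a statement of LNM 2270 (the source proves Cor. 6.37 under (F1) only); status CONDITIONAL: by the memo
BETA-UNITS-SCOPE every use of Thm 3.14 in the printed proof (Ch. 10) is at a closed point `x_i` of the sequence with a point
centre, where `ē_{x_i} ≤ ē_x` (Thm. 3.10 (4)), so the directrix theorem 2.14♯ supplies it under (F1♯) — «print + 2.14♯ +
memo», to be discharged (or refuted) by a page-by-page re-verification; consumed BY NAME as a hypothesis until then.
OURS node; not a citation of print; not asserted. -/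
def Corollary637_geomDir : Prop :=
  ∀ (T : BlowupTower.{u}) (N : ℕ) (x : T.X 0) (m : ℕ∞), KeySetting T N →
    @GeomDirHypothesis (T.X 0) (T.ln 0) x →
    IsFundamentalSequence T N x m → @IsIsolatedInHSMaxLocus (T.X 0) (T.ln 0) N x → T.dirDimAt 0 x = 1 →
      m < ⊤ ∧ ∀ q : ℕ, (q : ℕ∞) < m → ∃ ξ : T.X q, IsClosed ({ξ} : Set (T.X q)) ∧ T.C q = {ξ}

/-- [OURS · L1 W4.2] CJS Thm. 6.40 at isolated initial points with (F1) replaced by (F1♯) at the first initial point: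
the typed `KeyTheorem640_char_isolated` with `CharHypothesis (T.X 0) (pt 0)` ↦ `GeomDirHypothesis (T.X 0) (pt 0)`. Since a
fundamental unit has `ē = 2` at its initial point (Def. 6.38 (i)), (F1♯) holds there in EVERY characteristic, so this
`Prop` is EQUIVALENT to the typed char-free `KeyTheorem640_isolated` (`keyTheorem640_geomDir_isolated_iff`, companion file):
it is recorded only to make that bookkeeping explicit — the carrier consumed by the row is `KeyTheorem640_isolated`.
OURS node; NOT a statement of LNM 2270; not asserted. -/
def KeyTheorem640_geomDir_isolated : Prop :=
  ∀ (T : BlowupTower.{u}) (N : ℕ) (len : ℕ → ℕ) (pt : ∀ i, T.X (unitStart len i)), KeySetting T N →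
    @GeomDirHypothesis (T.X 0) (T.ln 0) (pt 0) →
    IsChainOfFundamentalUnits T N len pt →
    (∀ i, @IsIsolatedInHSMaxLocus (T.X (unitStart len i)) (T.ln _) N (pt i)) → False

/-! ## The unit-tower extraction WITHOUT the characteristic conjunct -/

/-- [OURS · L1 W4.2] **The bridge proper, moving form, characteristic-free conclusion** (= idea-2's
`UnitTowerExtractionM p` of `…Corridor3WLadderMovingDefs` §3a with the conjunct `CharHypothesis (T.X 0) (pt 0)` DROPPED from
the conclusion): from a maximal origin of characteristic `p` at level `3`, a MOVING `ē ≤ 2` chain which is isolated in the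
HS-locus infinitely often and has `e = ē = 2` at its isolated stages yields an infinite chain of fundamental units
(Def. 6.38/6.39, boundary-free) all of whose initial points are isolated in `X_max` — the antecedent of the char-free
`KeyTheorem640_isolated`. Buildable at `p = 2`, `dim X = 3` (where `CharHypothesis` is not: `3 + 2 ≤ 4` fails); the
construction is the same finite-segment bookkeeping as in the (F1) regime (ruling v3.8-B).
[cite: CossartJannsenSaito2020, Def. 6.34, Def. 6.38, Def. 6.39] -/
def UnitTowerExtractionFreeM (p : ℕ) : Prop :=
  ∀ (R : ∀ S : Scheme.{0}, CentreSeq S → Prop), OracleFunctional R → OracleAdmissible R →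
  ∀ (ν : ℕ → ℕ) (X : Scheme.{0}) [IsLocallyNoetherian X] (x : X), IsMaximalOrigin p 3 ν X x →
  ∀ c : ℕ → MarkedStage.{0}, Reaches R 3 ν (MarkedStage.init X x) (c 0) →
    (∀ n, CanonicalNearStep R 3 ν (c n) (c (n + 1))) → (∀ n, (c n).geomDirDim ≤ 2) →
    (∀ n, ∃ m, n ≤ m ∧ (c m).IsBlownUp R 3 ν) → (∀ n, ∃ m, n ≤ m ∧ Iso 3 (c m)) →
    (∀ n, Iso 3 (c n) → dirDim (c n) = 2 ∧ (c n).geomDirDim = 2) →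
    ∃ (T : BlowupTower.{0}) (len : ℕ → ℕ) (pt : ∀ i, T.X (unitStart len i)),
      KeySetting T 3 ∧ IsChainOfFundamentalUnits T 3 len pt ∧
      ∀ i, @IsIsolatedInHSMaxLocus (T.X (unitStart len i)) (T.ln _) 3 (pt i)

/-! ## (appended 2026-08-27, same seat) The (F1♯)-form of CJS Thm. 3.14's numerical shadow — the grade-0 binder -/

/-- [OURS · L1 W4.2] replaces the role of CJS Thm. 3.14 (Hironaka–Mizutani) for the row `stub_Wlow3M_two` (p = 2, dim X = 3,
any residue field): the typed numerical rendering `Theorem314_dim_lt_dirDim` («a point `x′` over `x ∈ D` NEAR to `x` under the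
blow-up of the permissible centre `D` forces `dim 𝒪_{D,x} < e_x(X)`», CJS Lemma 3.15 proof) with its characteristic hypothesis
(F1) `CharHypothesis X x` REPLACED by (F1♯) `GeomDirHypothesis X x` («`char κ(x) = 0 ∨ ē_x(X) + 2 ≤ 2·char κ(x)`»). NOT a
statement of LNM 2270; status CONDITIONAL — it is the numerical shadow of the directrix theorem 2.14♯ (CHAIN v3.8-D (D-1):
near points lie in `ℙ(Dir_x(X)/T_x(D))` whenever `char κ(x) = 0` or `ē_x(X) − dim_x D ≤ 2·char κ(x) − 2`; inputs [H4] Th. IV,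
[H5] Th. 2, Mizutani 1973 Thm. 2.8 and the kernel bound `dim B_{P,x′} ≤ ē_x − dim T_x(D)`), read with the point-centre bound
(so slightly WEAKER than the full 2.14♯ shadow), and STRONGER than the typed print-faithful fact (`CharHypothesis ⇒
GeomDirHypothesis`, `…MovingTwo.geomDirHypothesis_of_charHypothesis`). Consumed BY NAME as the grade-0 / third-door binder of
the characteristic-2 row (`…Corridor3WLadderMovingTwoGradeZero`). OURS node; not a citation of print; not asserted. -/
def Theorem314_geomDir : Prop :=
  ∀ (X X' : Scheme.{u}) [IsLocallyNoetherian X] [IsLocallyNoetherian X'] (π : X' ⟶ X) (D : X.IdealSheafData)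
    (N : ℕ) (x' : X') (x : X),
    Scheme.IsExcellent X → IdealSheafData.IsPermissible D → IsBlowup π D →
    topologicalKrullDim X ≤ (N : WithBot ℕ∞) → π.base x' = x → x ∈ (D.support : Set X) → GeomDirHypothesis X x →
    Scheme.hsFun X' N x' = Scheme.hsFun X N x →
      ringKrullDim (X.presheaf.stalk x ⧸ stalkIdeal D x) < (Scheme.dirDim X x : WithBot ℕ∞)

/-! ## (appended 2026-08-27, same seat) The THIRD-DOOR socket of the characteristic-2 row — all origins, grade `ē ≤ 2` -/

/-- [OURS · L1 W4.2] **THIRD-DOOR SOCKET of the row `stub_Wlow3M_two`, characteristic-free / all-origin twin of lead-1's re-cut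
socket `IsoLowDirDimTerminatesQM p`** (`…Corridor3WLadderMovingIsoLowQ`, which reads the (F1) regime `QCharRegime p` on the origin):
from a stage REACHED from ANY maximal origin at level `3` (any regime) that is ISOLATED in the Hilbert–Samuel locus with `e ≤ 1` AND
`ē ≤ 2`, there is no infinite MOVING chain of grade `ē ≤ 2`. Doors at `p = 2`: `e = 0` — the (F1♯) binder `Theorem314_geomDir`
(`…MovingTwoGradeZero.noMovingNearChainFrom_of_dirDim_eq_zero_geomDir`, PROVED reduction); `e = 1` — the OURS carrier
`Corollary637_geomDir` through a characteristic-free point-sequence extraction (finite-segment bridge; construction, OURS). Exactly what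
`wlowUnitsM_of_extraction_free` (p502286) consumes, named. OURS; NOT a statement of [CossartJannsenSaito2020].
[cite: CossartJannsenSaito2020, Cor. 6.37, Thm. 3.14] -/
def IsoLowDirDimTerminatesFreeM (p : ℕ) : Prop :=
  ∀ (R : ∀ S : Scheme.{0}, CentreSeq S → Prop), OracleFunctional R → OracleAdmissible R →
  ∀ (ν : ℕ → ℕ) (X : Scheme.{0}) [IsLocallyNoetherian X] (x : X), IsMaximalOrigin p 3 ν X x →
  ∀ s : MarkedStage.{0}, Reaches R 3 ν (MarkedStage.init X x) s → Iso 3 s → dirDim s ≤ 1 → s.geomDirDim ≤ 2 →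
    NoMovingNearChainFrom R 3 ν s fun t => t.geomDirDim ≤ 2

/-! ## (appended 2026-08-27, same seat) The (F1♯)-form of CJS Thm. 3.14 for POINT centres, LOCUS form — the grade-1 / unit binder -/

/-- [OURS · L1 W4.2] replaces the role of CJS Thm. 3.14 for a POINT centre in LOCUS form for the row `stub_Wlow3M_two`: res-type-053's
typed `Thm314_point_locus` («`π : X′ → X` the blow-up of the permissible closed point `x`, `x′` over `x` NEAR to `x` ⇒ `x′ ∈ ℙ(Dir_x(X))`»,
tree `IsOnProjDirectrix π x′`) with its characteristic hypothesis (F1) `CharHypothesis X x` REPLACED by (F1♯) `GeomDirHypothesis X x`.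
NOT a statement of LNM 2270; status CONDITIONAL — it is the point-centre case of the directrix theorem 2.14♯ (CHAIN v3.8-D (D-1), `dim_x D = 0`:
near points lie in `ℙ(Dir_x(X))` whenever `char κ(x) = 0` or `ē_x(X) ≤ 2·char κ(x) − 2`), STRONGER than the typed print-faithful fact.
Consumed BY NAME by the characteristic-free point-sequence / unit extractions (constructions (C1)/(C2) of `…MovingTwoThirdDoor`) at the
blown-up chain points of a W-low chain (`ē ≤ 2` ⇒ (F1♯) automatic). OURS node; not a citation of print; not asserted. -/
def Thm314_point_locus_geomDir : Prop :=
  ∀ (X X' : Scheme.{u}) [IsLocallyNoetherian X] (π : X' ⟶ X) (x : X) (hx : IsClosed ({x} : Set X)) (N : ℕ)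
    (x' : X'),
    Scheme.IsExcellent X →
    IdealSheafData.IsPermissible (Scheme.IdealSheafData.vanishingIdeal ⟨{x}, hx⟩) →
    IsBlowup π (Scheme.IdealSheafData.vanishingIdeal ⟨{x}, hx⟩) →
    topologicalKrullDim ↥X ≤ (N : WithBot ℕ∞) → π.base x' = x → GeomDirHypothesis X x →
    Scheme.hsFun X' N x' = Scheme.hsFun X N x → IsOnProjDirectrix π x'

/-! ## (appended 2026-08-27, same seat) The `e = 1` bridge at an isolated start, characteristic-free — the residue of the third door -/

/-- [OURS · L1 W4.2] **THE `e = 1` BRIDGE AT AN ISOLATED START, characteristic-free / all-origin twin of lead-1's `IsoE1BridgeM p`**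
(`…Corridor3WLadderThirdDoor`, which reads the (F1) regime `QCharRegime p` on the origin and concludes `CharHypothesis` at `x₀`): from a
stage `s` reached from ANY maximal origin at level `3` (`ν ≠ Φ^{(3)}`) whose marked point is ISOLATED in the Hilbert–Samuel locus with
`e = 1` and `ē ≤ 2`, every infinite MOVING chain of grade `ē ≤ 2` (reached) from `s` yields the FUNDAMENTAL SEQUENCE OF BLOW-UPS OVER a
point `x₀` OF LENGTH `∞` (CJS Def. 6.34 on a `BlowupTower` in the key setting, (F1♯) `GeomDirHypothesis` at `x₀`, `x₀` isolated,
`e_{x₀} = 1`) — the datum the OURS carrier `Corollary637_geomDir` forbids. A CONSTRUCTION owed by the B1′ / localisation programme read at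
`p = 2` (its doors there: `Theorem314_geomDir`, `Thm314_point_locus_geomDir`, the char-free `CossartJannsenSaito2020_thm_3_10_4`, and
the fact-free local tower of stub-2); OURS, NOT a statement of [CossartJannsenSaito2020]. [cite: CossartJannsenSaito2020, Def. 6.34, Cor. 6.37] -/
def IsoE1BridgeFreeM (p : ℕ) : Prop :=
  ∀ (R : ∀ S : Scheme.{0}, CentreSeq S → Prop), OracleFunctional R → OracleAdmissible R →
  ∀ (ν : ℕ → ℕ) (X : Scheme.{0}) [IsLocallyNoetherian X] (x : X), IsMaximalOrigin p 3 ν X x → ν ≠ iterPSum 3 Phi →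
  ∀ s : MarkedStage.{0}, Reaches R 3 ν (MarkedStage.init X x) s → Iso 3 s → dirDim s = 1 → s.geomDirDim ≤ 2 →
  ∀ c : ℕ → MarkedStage.{0}, Reaches R 3 ν s (c 0) → (∀ n, CanonicalNearStep R 3 ν (c n) (c (n + 1))) →
    (∀ n, (c n).geomDirDim ≤ 2) → (∀ n, ∃ m, n ≤ m ∧ (c m).IsBlownUp R 3 ν) →
    ∃ (T : BlowupTower.{0}) (x₀ : T.X 0),
      KeySetting T 3 ∧ @GeomDirHypothesis (T.X 0) (T.ln 0) x₀ ∧ IsFundamentalSequence T 3 x₀ ⊤ ∧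
      @IsIsolatedInHSMaxLocus (T.X 0) (T.ln 0) 3 x₀ ∧ T.dirDimAt 0 x₀ = 1

end Summit.ResolutionOfSingularities.ResolutionOfSingularities.Theorems.SigmaMaxModificationsCorridor3.Moving

end
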